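import Summits.QuantumFields.BalabanUV.Beta.D1BFx.SortedEmbedding
import Summits.QuantumFields.BalabanUV.Beta.BorderedHessianSymmetry

/-!
# `BalabanUV.Beta.D1BFx.PackedSortedBridges` — road «BF-x» for binder row D1, slot (K), chain step (I) «(A1)-PACKED», brick «COFRAME-ARRAYS»
# (TB4-W PART 3 at response-packed jets), FILE 0: **TWO BRIDGES INTO THE SORTED `(I ⊕ J)` CURRENCY OF THE (A2-N) DICTIONARY** —
# (i) a BOND array `K : MKer D F` embedded as the ff block of a packed `F ⊕ F` array (`embFF K`) periodises, in the sorted currency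
# `blocksHat p (sortK n (arr (n·p) ·))`, to `fromBlocks ((arr K)^.submatrix e₁ e₁) 0 0 0`; (ii) the RIGHT SIGN-TWIST `twistR K := sgnF b · K` over an1's `BorderedHessian.sgnF`
# (multiplier COLUMNS negated; `sgnK` = the two-sided twist) periodises to `blocksHat p (sortK n K) * fromBlocks 1 0 0 (−1)` — EXACTLY, no localisation needed —
# the torus-side shape `kkt k q * fromBlocks 1 0 0 (−1) = fromBlocks k (−qᵀ) q 0` of the twisted first N-jet `tj₂`.

HONEST DEPENDENCY (cell records, verbatim): «continuum YM on T⁴ ⇐ BetaPertH ∧ nine spine estimates (0/9 proved); BetaPertH ⇐ (D1) ∧ (D4) ∧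
CAP+tail; G-an2-4 gates asym, D1 and NE2/3/4.»  HONEST FRAMING (cell contract, verbatim): «discharging `BetaPertH` makes Bałaban's UV stability
UNCONDITIONAL — a real constructive-QFT result; it is NOT the continuum limit and NOT the Clay problem.»  THIS MODULE DISCHARGES NOTHING of (K),
of D1 or of the wall: [our object] two re-indexing∕sign DEFINITIONS (asserting nothing) and [folklore] bookkeeping over `SortedEmbedding`
(`periodiseF_reblock_eq_submatrix`), `SortedPack` (`sortK`'s block read-outs), `SortedKernels.blocksHat` and TA2 `PeriodicArrays` BY NAME.
No `def … : Prop`, nothing cited, 0 sorry.  0∕4 binders of row D1; (K) NOT closed; NOT D1, NOT BetaPertH, NOT continuum, NOT Clay.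

ABSOLUTE RULE (cell charter, verbatim): «No internally-minted statement may enter as a cited fact. Every hypothesis is either kernel-proved in this
package or a verbatim quotation of a PUBLISHED theorem with page reference. The manuscript(s) under audit are NOT citable for their own disputed
steps — they are the thing under adjudication; programme-internal (2001/route/tribunal) claims are never citable.»

CONTENT:
* §1 [our object] `embFF K` (ff-embedding of a bond array); `arr_embFF`, `biLoc_embFF`, **`blocksHat_sortK_arr_embFF`**:
  `blocksHat p (sortK n (arr (n·p) (embFF K))) = fromBlocks (((toF (arr (n·p) K))^).submatrix (e₁ n p) (e₁ n p)) 0 0 0` for a bi-localised `K`.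
* §2 [our object] `twistR K := sgnF b · K` (right sign-twist of a packed array, `BorderedHessian.sgnF`); `arr_twistR`, `biLoc_twistR`, **`blocksHat_sortK_twistR`**:
  `blocksHat p (sortK n (twistR K)) = blocksHat p (sortK n K) * fromBlocks 1 0 0 (−1)`; `fromBlocks_sgn_mul_self` (the sign matrix squares to `1`).
USE (sequel «COFRAME-PACK-1» `PackedCoframeWord`, and the (A2-N) assembly): `tj₂ (kₛ + B) qₛ = kkt kₛ qₛ * fromBlocks 1 0 0 (−1) + fromBlocks B 0 0 0`, the
first summand = `(arr (twistR 𝒱M))ˆˢ` by §2 and the M-side letter, the second = `(arr (embFF 𝒱cof))ˆˢ` by §1 and «COFRAME-PACK-1».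
Unit `b2b-balaban-beta-d1-formalise-leaf-03` (gen 23); road owner `b2b-balaban-beta-d1-p2` (`OWNER-MEMO-g17.md` §2 item (2)).
-/

noncomputable section

namespace Summit.QuantumFields.BalabanUV.Beta.D1BFx.PackedSortedBridges

open Matrix
open scoped BigOperators
open Literature.Probability.LatticeModels (TorusSite)
open Literature.MathematicalPhysics.QuantumFieldTheory.Balaban1983to89
open Literature.MathematicalPhysics.QuantumFieldTheory.Balaban1983to89.Beta
open ExpKernelCalculus (MKer BiLoc)
open OneStepResolventKernel (Fib)
open Summit.QuantumFields.BalabanUV.Beta.BorderedHessian (sgnF sgnF_inl sgnF_inr)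
open Summit.QuantumFields.BalabanUV.Beta.D1BFx.FibredPeriodisation (FKer periodiseF periodiseF_apply periodiseF_const_mul)
open Summit.QuantumFields.BalabanUV.Beta.D1BFx.SortedKernels (blocksHat fTL fTR fBL fBR periodiseF_zero)
open Summit.QuantumFields.BalabanUV.Beta.D1BFx.SortedReblocking (reblock)
open Summit.QuantumFields.BalabanUV.Beta.D1BFx.SortedPack (sortK sortK_inl_inl sortK_inl_inr sortK_inr_inl sortK_inr_inr fTL_sortK)
open Summit.QuantumFields.BalabanUV.Beta.D1BFx.SortedEmbedding (e₁ periodiseF_reblock_eq_submatrix)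
open Summit.QuantumFields.BalabanUV.Beta.D1BFx.PeriodicArrays (arr arr_apply toF Kfib_toF rowBound_arr arr_imageShift)
open Summit.QuantumFields.BalabanUV.Beta.D1BFx.PackedKernelSplit (blk)

variable {D : ℕ} {F : Type*}

/-! ## §1 The ff-embedding of a bond array -/

section EmbFF

/-- [our object] **THE ff-EMBEDDING** of a bond array `K : MKer D F` into the packed fibre `F ⊕ F`: `(inl α, inl β) ↦ K x y α β`, every entry with a
multiplier leg `0`.  A definition; asserts nothing. -/
def embFF (K : MKer D F) : MKer D (F ⊕ F) := fun x y a b =>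
  match a, b with
  | Sum.inl α, Sum.inl β => K x y α β
  | Sum.inl _, Sum.inr _ => 0
  | Sum.inr _, Sum.inl _ => 0
  | Sum.inr _, Sum.inr _ => 0

variable (K : MKer D F)

/-- [our object] The ff entries of `embFF K`. -/
@[simp] theorem embFF_inl_inl (x y : Fin D → ℤ) (α β : F) : embFF K x y (Sum.inl α) (Sum.inl β) = K x y α β := rfl
/-- [our object] The fm entries vanish. -/
@[simp] theorem embFF_inl_inr (x y : Fin D → ℤ) (α β : F) : embFF K x y (Sum.inl α) (Sum.inr β) = 0 := rfl
/-- [our object] The mf entries vanish. -/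
@[simp] theorem embFF_inr_inl (x y : Fin D → ℤ) (α β : F) : embFF K x y (Sum.inr α) (Sum.inl β) = 0 := rfl
/-- [our object] The mm entries vanish. -/
@[simp] theorem embFF_inr_inr (x y : Fin D → ℤ) (α β : F) : embFF K x y (Sum.inr α) (Sum.inr β) = 0 := rfl

/-- [our object] The ff block of `embFF K` is `K`. -/
theorem blk_embFF_tt : blk (embFF K) true true = K := by
  funext x y a b
  rfl

/-- [folklore] **THE ARRAY PASSES THROUGH THE EMBEDDING**: `arr s (embFF K) = embFF (arr s K)`. -/
theorem arr_embFF (s : ℕ) : arr s (embFF K) = embFF (arr s K) := by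
  funext x y a b
  rcases a with α | α <;> rcases b with β | β
  · rfl
  · show (∑' _ : Fin D → ℤ, (0 : ℝ)) = 0
    exact tsum_zero
  · show (∑' _ : Fin D → ℤ, (0 : ℝ)) = 0
    exact tsum_zero
  · show (∑' _ : Fin D → ℤ, (0 : ℝ)) = 0
    exact tsum_zero

/-- [folklore] The embedding preserves bi-localisation (same points, constant, rate). -/
theorem biLoc_embFF {P Q : Fin D → ℤ} {C δ : ℝ} (hK : BiLoc K P Q C δ) : BiLoc (embFF K) P Q C δ := by
  intro x y a b
  rcases a with α | α <;> rcases b with β | β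
  · exact hK x y α β
  · rw [embFF_inl_inr, abs_zero]; exact mul_nonneg (hK.nonneg α) (Real.exp_pos _).le
  · rw [embFF_inr_inl, abs_zero]; exact mul_nonneg (hK.nonneg α) (Real.exp_pos _).le
  · rw [embFF_inr_inr, abs_zero]; exact mul_nonneg (hK.nonneg α) (Real.exp_pos _).le

variable {K} (n p : ℕ) [NeZero n] [NeZero p]

/-- [folklore] **THE SORTED CURRENCY OF AN EMBEDDED BOND ARRAY**: for a bi-localised bond array `K` on the fine lattice,
`blocksHat p (sortK n (arr (n·p) (embFF K))) = fromBlocks (((toF (arr (n·p) K))^).submatrix (e₁ n p) (e₁ n p)) 0 0 0` — the ff block is the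
fine-torus periodisation of TA2's array re-indexed to the sorted bonds (`SortedEmbedding.periodiseF_reblock_eq_submatrix`), the three blocks with a
multiplier leg vanish. -/
theorem blocksHat_sortK_arr_embFF {P Q : Fin D → ℤ} {C δ : ℝ} (hK : BiLoc K P Q C δ) (hδ : 0 < δ) :
    blocksHat p (sortK n (arr (n * p) (embFF K)))
      = Matrix.fromBlocks ((Matrix.of (periodiseF (n * p) (toF (arr (n * p) K)))).submatrix (e₁ n p) (e₁ n p)) 0 0 0 := by
  rw [arr_embFF]
  have hTL : Matrix.of (periodiseF p (fTL (sortK n (embFF (arr (n * p) K)))))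
      = (Matrix.of (periodiseF (n * p) (toF (arr (n * p) K)))).submatrix (e₁ n p) (e₁ n p) := by
    rw [fTL_sortK, blk_embFF_tt]
    exact periodiseF_reblock_eq_submatrix (fun a b x x' t => arr_imageShift (n * p) K x x' t a b)
      (fun a b x => ((rowBound_arr hK hδ (n * p) a b) x).1.of_abs)
  have hTR : fTR (sortK n (embFF (arr (n * p) K))) = fun _ _ => (0 : ℝ) := by
    funext ⟨y, z, a⟩ ⟨y', b⟩
    show sortK n (embFF (arr (n * p) K)) (y, Sum.inl (z, a)) (y', Sum.inr b) = 0
    rw [sortK_inl_inr]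
    rfl
  have hBL : fBL (sortK n (embFF (arr (n * p) K))) = fun _ _ => (0 : ℝ) := by
    funext ⟨y, a⟩ ⟨y', z', b⟩
    show sortK n (embFF (arr (n * p) K)) (y, Sum.inr a) (y', Sum.inl (z', b)) = 0
    rw [sortK_inr_inl]
    rfl
  have hBR : fBR (sortK n (embFF (arr (n * p) K))) = fun _ _ => (0 : ℝ) := by
    funext ⟨y, a⟩ ⟨y', b⟩
    show sortK n (embFF (arr (n * p) K)) (y, Sum.inr a) (y', Sum.inr b) = 0
    rw [sortK_inr_inr]
    rfl
  rw [blocksHat, hTL, hTR, hBL, hBR, periodiseF_zero, periodiseF_zero, periodiseF_zero]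

end EmbFF

/-! ## §2 The right sign-twist of a packed array -/

section TwistR

variable {d : ℕ}

/-- [our object] **THE RIGHT SIGN-TWIST** of a packed array over an1's fibre sign `sgnF` (`+1` on field legs, `−1` on multiplier legs):
`twistR K x y a b := sgnF b · K x y a b` — the entries with a multiplier COLUMN leg change sign (the ONE-SIDED half of `BorderedHessian.sgnK`,
which is `sgnF a · sgnF b · K`).  A definition; asserts nothing. -/
def twistR (K : MKer D (Fib d)) : MKer D (Fib d) := fun x y a b => sgnF b * K x y a b

variable (K : MKer D (Fib d))

/-- [our object] Field-column entries are unchanged. -/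
@[simp] theorem twistR_inl (x y : Fin D → ℤ) (a : Fib d) (β : Fin (d + 1)) : twistR K x y a (Sum.inl β) = K x y a (Sum.inl β) := by
  rw [twistR, sgnF_inl, one_mul]
/-- [our object] Multiplier-column entries change sign. -/
@[simp] theorem twistR_inr (x y : Fin D → ℤ) (a : Fib d) (β : Fin (d + 1)) : twistR K x y a (Sum.inr β) = -K x y a (Sum.inr β) := by
  rw [twistR, sgnF_inr, neg_one_mul]

/-- [folklore] The twist is an involution. -/
theorem twistR_twistR : twistR (twistR K) = K := by
  funext x y a b
  rcases b with β | β
  · rw [twistR_inl, twistR_inl]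
  · rw [twistR_inr, twistR_inr, neg_neg]

/-- [folklore] **THE ARRAY PASSES THROUGH THE TWIST**: `arr s (twistR K) = twistR (arr s K)`. -/
theorem arr_twistR (s : ℕ) : arr s (twistR K) = twistR (arr s K) := by
  funext x y a b
  show (∑' t : Fin D → ℤ, sgnF b * K (imageShift s x t) (imageShift s y t) a b) = sgnF b * ∑' t : Fin D → ℤ, K (imageShift s x t) (imageShift s y t) a b
  exact tsum_mul_left

/-- [folklore] The twist preserves bi-localisation (same points, constant, rate). -/
theorem biLoc_twistR {P Q : Fin D → ℤ} {C δ : ℝ} (hK : BiLoc K P Q C δ) : BiLoc (twistR K) P Q C δ := by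
  intro x y a b
  rcases b with β | β
  · rw [twistR_inl]; exact hK x y a (Sum.inl β)
  · rw [twistR_inr, abs_neg]; exact hK x y a (Sum.inr β)

/-- [folklore] The twist commutes with pointwise limits: if `K k → K∞` entrywise then `twistR (K k) → twistR K∞` entrywise. -/
theorem tendsto_twistR_apply {Kk : ℕ → MKer D (Fib d)} {Kinf : MKer D (Fib d)} (x y : Fin D → ℤ) (a b : Fib d)
    (h : Filter.Tendsto (fun k => Kk k x y a b) Filter.atTop (nhds (Kinf x y a b))) :
    Filter.Tendsto (fun k => twistR (Kk k) x y a b) Filter.atTop (nhds (twistR Kinf x y a b)) := by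
  rcases b with β | β
  · simp only [twistR_inl]; exact h
  · simp only [twistR_inr]; exact h.neg

/-- [folklore] Negation passes through the fibred periodisation (no summability needed: `tsum_neg`). -/
theorem periodiseF_neg_matrix {d : ℕ} {α β : Type*} (s : ℕ) [NeZero s] (Q : FKer d α β) :
    Matrix.of (periodiseF s (fun i j => -Q i j)) = -Matrix.of (periodiseF s Q) := by
  ext i j
  rw [Matrix.neg_apply, Matrix.of_apply, Matrix.of_apply,
    show (fun i' j' => -Q i' j') = (fun i' j' => (-1 : ℝ) * Q i' j') from funext fun _ => funext fun _ => (neg_one_mul _).symm,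
    periodiseF_const_mul, neg_one_mul]

variable (n p : ℕ) [NeZero n] [NeZero p]

/-- [folklore] **THE SORTED CURRENCY OF THE TWIST — EXACT**: `blocksHat p (sortK n (twistR K)) = blocksHat p (sortK n K) * fromBlocks 1 0 0 (−1)`
(the ff and mf blocks are unchanged, the fm and mm blocks change sign; no localisation hypothesis). -/
theorem blocksHat_sortK_twistR :
    blocksHat p (sortK n (twistR K))
      = blocksHat p (sortK n K) * Matrix.fromBlocks (1 : Matrix (Beta.Site D p × (TorusSite D n × Fin (d + 1))) (Beta.Site D p × (TorusSite D n × Fin (d + 1))) ℝ) 0 0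
          (-1 : Matrix (Beta.Site D p × Fin (d + 1)) (Beta.Site D p × Fin (d + 1)) ℝ) := by
  have hTL : fTL (sortK n (twistR K)) = fTL (sortK n K) := by
    funext ⟨y, z, a⟩ ⟨y', z', b⟩
    show sortK n (twistR K) (y, Sum.inl (z, a)) (y', Sum.inl (z', b)) = sortK n K (y, Sum.inl (z, a)) (y', Sum.inl (z', b))
    rw [sortK_inl_inl, sortK_inl_inl, twistR_inl]
  have hTR : fTR (sortK n (twistR K)) = fun i j => -fTR (sortK n K) i j := by
    funext ⟨y, z, a⟩ ⟨y', b⟩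
    show sortK n (twistR K) (y, Sum.inl (z, a)) (y', Sum.inr b) = -sortK n K (y, Sum.inl (z, a)) (y', Sum.inr b)
    rw [sortK_inl_inr, sortK_inl_inr, twistR_inr]
  have hBL : fBL (sortK n (twistR K)) = fBL (sortK n K) := by
    funext ⟨y, a⟩ ⟨y', z', b⟩
    show sortK n (twistR K) (y, Sum.inr a) (y', Sum.inl (z', b)) = sortK n K (y, Sum.inr a) (y', Sum.inl (z', b))
    rw [sortK_inr_inl, sortK_inr_inl, twistR_inl]
  have hBR : fBR (sortK n (twistR K)) = fun i j => -fBR (sortK n K) i j := by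
    funext ⟨y, a⟩ ⟨y', b⟩
    show sortK n (twistR K) (y, Sum.inr a) (y', Sum.inr b) = -sortK n K (y, Sum.inr a) (y', Sum.inr b)
    rw [sortK_inr_inr, sortK_inr_inr, twistR_inr]
  rw [blocksHat, blocksHat, hTL, hTR, hBL, hBR, periodiseF_neg_matrix, periodiseF_neg_matrix, Matrix.fromBlocks_multiply]
  simp only [Matrix.mul_one, Matrix.mul_zero, Matrix.mul_neg, add_zero, zero_add]

/-- [folklore] **THE SIGN MATRIX SQUARES TO ONE**: `fromBlocks 1 0 0 (−1) * fromBlocks 1 0 0 (−1) = 1`. -/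
theorem fromBlocks_sgn_mul_self {ι κ : Type*} [Fintype ι] [Fintype κ] [DecidableEq ι] [DecidableEq κ] :
    Matrix.fromBlocks (1 : Matrix ι ι ℝ) 0 0 (-1 : Matrix κ κ ℝ) * Matrix.fromBlocks (1 : Matrix ι ι ℝ) 0 0 (-1 : Matrix κ κ ℝ) = 1 := by
  rw [Matrix.fromBlocks_multiply]
  simp only [Matrix.mul_one, Matrix.mul_zero, Matrix.mul_neg, neg_zero, neg_neg, add_zero, zero_add, Matrix.fromBlocks_one]

/-- [folklore] **UNDOING THE SIGN MATRIX**: `X * fromBlocks 1 0 0 (−1) = Y ↔ X = Y * fromBlocks 1 0 0 (−1)`. -/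
theorem mul_sgn_eq_iff {ι κ : Type*} [Fintype ι] [Fintype κ] [DecidableEq ι] [DecidableEq κ] (X Y : Matrix (ι ⊕ κ) (ι ⊕ κ) ℝ) :
    X * Matrix.fromBlocks (1 : Matrix ι ι ℝ) 0 0 (-1 : Matrix κ κ ℝ) = Y
      ↔ X = Y * Matrix.fromBlocks (1 : Matrix ι ι ℝ) 0 0 (-1 : Matrix κ κ ℝ) := by
  constructor
  · intro h; rw [← h, Matrix.mul_assoc, fromBlocks_sgn_mul_self, Matrix.mul_one]
  · intro h; rw [h, Matrix.mul_assoc, fromBlocks_sgn_mul_self, Matrix.mul_one]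

end TwistR

end Summit.QuantumFields.BalabanUV.Beta.D1BFx.PackedSortedBridges

end
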